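import Summits.CriticalPhenomena.PercolationContinuityZ3.Theorems.Transplant.PlanarSkeletonDefs
import Summits.CriticalPhenomena.PercolationContinuityZ3.Theorems.Transplant.HeisenbergPlanarSkeleton
import HarnessLib

/-!
# The DROP form of the planar-skeleton node (design (D) 'CONCENTRIC', V56) and its conditional closures

builds on p205010 (kernel theorem, internal audit signed; external expert review pending).
Status sentence (coordinator 2026-08-20T04:30Z): "θ(p_c) = 0 on ℤ^d, all d ≥ 2 — kernel-verified (Lean 4/Mathlib,
standard axioms); internal adversarial audit SIGNED 2026-08-20 04:29Z; external expert review pending."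

Lane `prim-bschramm`, seat `prim-bschramm-p4` (gen 2; class map), helper file (`--supports stmt-CriticalPhenomena-4575`).
The lane's design of record for the re-typing of Kozma–Nitzan §4 over thick fibres is now (D) 'CONCENTRIC' (HOME/ENTRY-SEED-STAR.md
§10, VERDICTS V56): radii grow along the exploration, so the same-`p` witness no longer has uniformly bounded envelopes and the
continuation principle is applied in Kozma–Nitzan's own form — RE-RUN the construction at a smaller density.  The node therefore takes
the DROP shape (lead (g2) → p4-g2, 13:23Z: "the general-skeleton analogue is the same sentence"):
* `SamePDropOfSkeleton` (`@[conjecture]`, never asserted) — on a connected locally finite graph with a planar skeleton, at every density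
  `p` with a.s. uniqueness, subcritical cylinders and `θ_t(p) > 0` at a base vertex, there is `q < p` with `θ_t(q) > 0`;
* `samePDropOfSkeleton_of_witness : SamePWitnessOfSkeleton → SamePDropOfSkeleton` — the witness node (p209682) implies the drop node,
  by p4's continuation principle `SameP.criticalProb_lt_of_lawful` (p207164) and `θ > 0` above `p_c`; so every reduction from the drop
  node is at least as strong as the corresponding one from the witness node;
* `theta_criticalProbIOf_eq_zero_of_drop_at` — the closing step needs the drop property AT `p_c` only;
* `continuity_of_skeleton_drop(_amenable)` — drop node + uniqueness at `p_c` (Burton–Keane on amenable quasi-transitive graphs) +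
  cylinders at `p_c` ⇒ `θ_t(p_c) = 0`;
* instance: `heisenbergCriticalContinuity_of_dropNode : SamePDropOfSkeleton → HeisenbergCriticalContinuity` (H₃(ℤ): cylinders
  subcritical by bounded cutsets, p208219).  The `H₃(ℤ) × ℤ` analogue (with the residue `HeisenbergZCylSubcritical`) rides with
  `Transplant/HeisenbergZCylinderSteering.lean`.
[cite: KozmaNitzan2024, §1 p. 2 (approach 1); §4 p. 31 (the continuity step)] [cite: BenjaminiSchramm1996, Conj. 4] [cite: LyonsPeres2016, Thm. 7.6]
-/

noncomputable section

namespace Summit.CriticalPhenomena.PercolationContinuityZ3.Theorems.Transplant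

open MeasureTheory Literature.Probability.Percolation Literature.Probability.LatticeModels
open Literature.Probability.Percolation.GM
open Literature.Geometry.MetricEmbeddings
open Literature.Barriers.CriticalPhenomena (IsQuasiTransitive IsGraphAmenable BurtonKeane1989_atMostOneInfiniteCluster_holds)

/-- **THE DROP NODE over a planar skeleton** (design (D)): Kozma–Nitzan §4 re-run at a smaller density in skeleton coordinates.
NOT in print, NOT proved, never asserted. [cite: KozmaNitzan2024, §4 pp. 15–31; §1 p. 2 (approach 1)] [cite: BenjaminiSchramm1996, Conj. 4] -/
@[conjecture] def SamePDropOfSkeleton : Prop :=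
  ∀ {V : Type} [DecidableEq V] [Countable V] (G : SimpleGraph V) [G.LocallyFinite] (Φ : PlanarSkeleton G),
    G.Connected → ∀ t ∈ Φ.types, ∀ p : unitInterval,
      (∀ᵐ ω ∂bondPercolation G p, numInfiniteClusters ω ≤ 1) → Φ.CylSubcritical p → 0 < theta G t p →
        ∃ q : unitInterval, (q : ℝ) < p ∧ 0 < theta G t q

/-- **The witness node implies the drop node**: a same-`p` witness with bounded envelopes at `p` gives `p_c(G,t) < p`
(p4's `SameP.criticalProb_lt_of_lawful`), and `θ_t > 0` strictly above `p_c`. [cite: KozmaNitzan2024, §1 p. 2 (approach 1)] -/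
theorem samePDropOfSkeleton_of_witness (hW : SamePWitnessOfSkeleton) : SamePDropOfSkeleton := by
  intro V _ _ G _ Φ hc t ht p hU hC hθ
  obtain ⟨S, ε, N, hL, hε, hN, hU0, hperc⟩ := hW G Φ hc t ht p hU hC hθ
  have hp0 : 0 < (p : ℝ) := by
    rcases p.2.1.eq_or_lt with h0 | h0
    · exfalso
      have e : p = 0 := Subtype.ext h0.symm
      rw [e, theta_bot] at hθ
      exact lt_irrefl _ hθ
    · exact h0
  have hlt : criticalProb G t < p := SameP.criticalProb_lt_of_lawful hL hε hN hU0 hp0 hperc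
  -- the midpoint between `p_c` and `p`
  have hpc0 : 0 ≤ criticalProb G t := (criticalProb_mem_Icc G t).1
  have hq1 : (criticalProb G t + p) / 2 ≤ 1 := by linarith [p.2.2]
  refine ⟨⟨(criticalProb G t + p) / 2, by positivity, hq1⟩, ?_, ?_⟩
  · show (criticalProb G t + (p : ℝ)) / 2 < p
    linarith
  · exact theta_pos_of_criticalProb_lt_holds G t _ (by show criticalProb G t < (criticalProb G t + (p : ℝ)) / 2; linarith)

/-- **Closing step at `p_c` only**: if `θ_x(p_c) > 0` would force `θ_x(q) > 0` for some `q < p_c`, then `θ_x(p_c) = 0`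
(`θ_x(q) = 0` below `p_c` by definition). [cite: KozmaNitzan2024, §1 p. 2 (approach 1)] -/
theorem theta_criticalProbIOf_eq_zero_of_drop_at {V : Type} [Countable V] (G : SimpleGraph V) (x : V)
    (h : 0 < theta G x (criticalProbIOf G x) → ∃ q : unitInterval, (q : ℝ) < criticalProb G x ∧ 0 < theta G x q) :
    theta G x (criticalProbIOf G x) = 0 := by
  by_contra hne
  have hpos : 0 < theta G x (criticalProbIOf G x) := lt_of_le_of_ne measureReal_nonneg (Ne.symm hne)
  obtain ⟨q, hq, hθq⟩ := h hpos
  have h0 : theta G x q = 0 := theta_eq_zero_of_lt_criticalProb_holds G x q hq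
  rw [h0] at hθq
  exact lt_irrefl _ hθq

/-- **Conditional continuity from the drop node**: uniqueness and cylinders at `p_c` give `θ_t(p_c) = 0` at every base vertex.
[cite: KozmaNitzan2024, §1 p. 2 (approach 1)] -/
theorem continuity_of_skeleton_drop (hD : SamePDropOfSkeleton) {V : Type} [DecidableEq V] [Countable V]
    (G : SimpleGraph V) [G.LocallyFinite] (Φ : PlanarSkeleton G) (hc : G.Connected) (t : V) (ht : t ∈ Φ.types)
    (hU : ∀ᵐ ω ∂bondPercolation G (criticalProbIOf G t), numInfiniteClusters ω ≤ 1)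
    (hC : Φ.CylSubcritical (criticalProbIOf G t)) : theta G t (criticalProbIOf G t) = 0 :=
  theta_criticalProbIOf_eq_zero_of_drop_at G t fun hpos => hD G Φ hc t ht _ hU hC hpos

/-- **… on connected, locally finite, quasi-transitive AMENABLE graphs** (uniqueness by the tree's Burton–Keane).
[cite: BenjaminiSchramm1996, Conj. 4] [cite: LyonsPeres2016, Thm. 7.6] -/
theorem continuity_of_skeleton_drop_amenable (hD : SamePDropOfSkeleton) {V : Type} [DecidableEq V]
    (G : SimpleGraph V) [G.LocallyFinite] (Φ : PlanarSkeleton G) (hc : G.Connected) (hq : IsQuasiTransitive G)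
    (ha : IsGraphAmenable G) (t : V) (ht : t ∈ Φ.types) (hC : Φ.CylSubcritical (criticalProbIOf G t)) :
    theta G t (criticalProbIOf G t) = 0 :=
  haveI : Countable V := Literature.Barriers.CriticalPhenomena.countable_of_connected_of_locallyFinite G hc t
  continuity_of_skeleton_drop hD G Φ hc t ht (BurtonKeane1989_atMostOneInfiniteCluster_holds G hc hq ha _) hC

/-- **`θ_{H₃(ℤ)}(p_c) = 0` from the drop node** (no residue: cylinders subcritical by bounded cutsets at `p_c < 1`).
[cite: BenjaminiSchramm1996, Conj. 4] [cite: CheegerKleinerNaor2011, §1.1] -/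
theorem heisenbergCriticalContinuity_of_dropNode (hD : SamePDropOfSkeleton) : HeisenbergCriticalContinuity := by
  unfold HeisenbergCriticalContinuity
  refine continuity_of_skeleton_drop_amenable hD cayleyGraph heisSkeleton cayleyGraph_connected isQuasiTransitive_heisenberg
    isGraphAmenable_heisenberg (0, 0, 0) (Finset.mem_singleton_self _) ?_
  refine heisSkeleton_cylSubcritical _ ?_
  change criticalProb cayleyGraph ((0, 0, 0) : ℤ × ℤ × ℤ) < 1
  exact criticalProb_heisenberg_lt_one

end Summit.CriticalPhenomena.PercolationContinuityZ3.Theorems.Transplant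

end
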